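import Literature.AlgebraicGeometry.Modules.PullbackContract
import Literature.AlgebraicGeometry.Modules.TrivialisationGenerators
import HarnessLib

/-!
# The rigidification-normalised generator of a trivialised pull-back and its cofaces read along sections (LEMMA Y)

Topic `Literature/AlgebraicGeometry/Morphisms`, namespaces `Literature.AlgebraicGeometry.Modules` (§0a) and
`Literature.AlgebraicGeometry.Morphisms`.  THEOREMS ONLY; no definition, no named fact, no instance, no notation, no
`sorry`.  Generic scheme-level core (no abelian schemes) of the fpqc descent of TRIVIALISATIONS of rigidified line bundles
(cell `hodgecm-mathlib`, HECKE-LINK H2, D6 brick (u6b); sequel: `Morphisms/TrivialisationFpqcDescent`,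
instantiation: `AbelianSchemes/RigidifiedTrivialFpqcDescent`).

Setting ([MumfordAV1970] §13 p. 125, the proof that the isomorphism `(1 × g)^*𝒫 ≅ ℒ` descends; [SGA1] VIII 1.1):
`e : T → X` (think: the unit section of an abelian scheme `X = A_T → T`), `g : Z → X` (think `1_A × c : A_{T₁} → A_T`
for a faithfully flat `c : T₁ → T`), `e₁ : T₁ → Z` a section of `π₁ : Z → T₁` with `e₁ ≫ g = c ≫ e`; a module `L` on `X`
RIGIDIFIED along `e` (`ρ : e^*L ≅ 𝒪_T`) with `g^*L` TRIVIAL (`φ₀ : g^*L ≅ 𝒪_Z`).  Everything is read on GLOBAL sections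
with every component at `⊤` (the normal form of ★ `Modules/TrivialisationGenerators`).

* §0a more elementwise transport bookkeeping (`app_app_top_congr`, `pullbackComp_hom_app_unitSection_congr_base`,
  `pullbackComp_hom_app_app_pullback_map_pullbackCongr`, `natIso_{inv,hom}_app_app_{hom,inv}_app_app`);
* §0 the comparison `u_v : v^*𝒪 → 𝒪` (★ `Modules/PullbackDual.pullbackUnitComparison`) on unit sections;
* §1 **`exists_isUnit_normalised`** — a unit `a ∈ Γ(T₁, 𝒪)^×` such that the generator `s₁ := φ₀⁻¹(π₁♯ a)` is
  NORMALISED: `η_{e₁}(s₁)` read in `(c ≫ e)^*L` is `η_c(ρ⁻¹ 1)` read in `(c ≫ e)^*L`;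
* §2 **LEMMA Y `unitSection_coface_eq_transport`** — for a second level `e′ : T′ → Z′`, `p : Z′ → Z`, `w : T′ → T₁`
  with `e′ ≫ p = w ≫ e₁`: `η_{e′}` of the `p`-coface of a normalised `s₁` is (the transport of) `η_{w ≫ c}(ρ⁻¹ 1)` —
  three uses of the associativity of `pullbackComp` (Mathlib `SheafOfModules.pullback_assoc` through ★
  `Modules.pullbackComp_assoc_hom_app_apply`) and transport along the two section equations.

HC_CM is proved only modulo the 7 printed citations until rung 0 closes; nothing here is about HC.

## References
* [MumfordAV1970] D. Mumford, *Abelian Varieties* (1970), §13 (p. 125), §5 Cor. 6 (p. 54).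
* [MumfordFogartyKirwan1994] D. Mumford, J. Fogarty, F. Kirwan, *GIT*, 3rd ed. (1994), Ch. 6 §2 (p. 121) (rigidification).
* [SGA1] A. Grothendieck, *SGA 1*, Exp. VIII §1, Thm. 1.1, Cor. 1.2.
* [StacksProject] The Stacks Project, Tag 023M (Descent, Lemma 35.3.6), Tag 0097 (Sheaves, Lemma 6.26.3), Tag 0095 (Sheaves, Def. 6.26.1).
* [GortzWedhorn2020] U. Görtz, T. Wedhorn, *Algebraic Geometry I*, 2nd ed. (2020), Prop. 14.66, (7.8).
* [Hartshorne1977] R. Hartshorne, *Algebraic Geometry*, GTM 52 (1977), II §5 (pp. 109–110).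
-/

noncomputable section

-- `TopCat.Presheaf`/`Scheme.Modules` are not reducible (as in Mathlib's `AlgebraicGeometry/Modules`).
set_option backward.isDefEq.respectTransparency false

universe u

open CategoryTheory CategoryTheory.Limits AlgebraicGeometry TopologicalSpace Opposite

namespace Literature.AlgebraicGeometry.Modules

/-! ## §0a More elementwise transport bookkeeping (sequel of ★ `Modules/TrivialisationGenerators`) -/

section Transport

variable {Y Z : Scheme.{u}}


/-- **`f♯(g♯ a) = f′♯(g′♯ a)`** on global functions when `f ≫ g = f′ ≫ g′`. [cite: GortzWedhorn2020, (7.8)] -/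
theorem app_app_top_congr {X Y Y' Z : Scheme.{u}} {f : X ⟶ Y} {g : Y ⟶ Z} {f' : X ⟶ Y'} {g' : Y' ⟶ Z}
    (h : f ≫ g = f' ≫ g') (a : Γ(Z, ⊤)) :
    (show Γ(X, ⊤) from f.app (g ⁻¹ᵁ ⊤) (g.app ⊤ a)) = f'.app (g' ⁻¹ᵁ ⊤) (g'.app ⊤ a) := by
  have h1 : f.app (g ⁻¹ᵁ ⊤) (g.app ⊤ a) = (f ≫ g).app ⊤ a := by rw [Scheme.Hom.comp_app]; rfl
  have h2 : f'.app (g' ⁻¹ᵁ ⊤) (g'.app ⊤ a) = (f' ≫ g').app ⊤ a := by rw [Scheme.Hom.comp_app]; rfl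
  change f.app (g ⁻¹ᵁ ⊤) (g.app ⊤ a) = f'.app (g' ⁻¹ᵁ ⊤) (g'.app ⊤ a)
  rw [h1, h2, Scheme.Hom.congr_app h ⊤]
  change X.presheaf.map (eqToHom _).op ((f' ≫ g').app ⊤ a) = (f' ≫ g').app ⊤ a
  have h3 : ∀ (q : (⊤ : X.Opens) = ⊤) (b : Γ(X, ⊤)), X.presheaf.map (eqToHom q).op b = b := fun q b => by
    rw [eqToHom_refl, op_id, CategoryTheory.Functor.map_id]; rfl
  exact h3 _ _

/-- **`pullbackComp` along equal first morphisms, inner form** (global sections, components at `⊤`): for `q = q'`, the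
`(q ≫ e)^*`-reading of `η_q(r)` is the transport of the `(q' ≫ e)^*`-reading of `η_{q'}(r)`. [cite: StacksProject, Tag 0097] -/
theorem pullbackComp_hom_app_unitSection_congr_base {T' : Scheme.{u}} {q q' : T' ⟶ Y} (hq : q = q') (e : Y ⟶ Z)
    (N : Z.Modules) (r : Γ((Scheme.Modules.pullback e).obj N, ⊤)) :
    ((Scheme.Modules.pullbackComp q e).hom.app N).app ⊤
        (unitSection q ((Scheme.Modules.pullback e).obj N) ⊤ r) =
      ((Scheme.Modules.pullbackCongr (show q' ≫ e = q ≫ e by rw [hq])).hom.app N).app ⊤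
        (((Scheme.Modules.pullbackComp q' e).hom.app N).app ⊤
          (unitSection q' ((Scheme.Modules.pullback e).obj N) ⊤ r)) := by
  subst hq; rfl

/-- Elementwise form of `pullback_map_pullbackCongr_comp_pullbackComp`. [cite: StacksProject, Tag 0097] -/
theorem pullbackComp_hom_app_app_pullback_map_pullbackCongr {T' : Scheme.{u}} (w : T' ⟶ Y) {v v' : Y ⟶ Z}
    (hv : v = v') (N : Z.Modules) (U : T'.Opens)
    (x : Γ((Scheme.Modules.pullback w).obj ((Scheme.Modules.pullback v).obj N), U)) :
    ((Scheme.Modules.pullbackComp w v').hom.app N).app U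
        (((Scheme.Modules.pullback w).map ((Scheme.Modules.pullbackCongr hv).hom.app N)).app U x) =
      ((Scheme.Modules.pullbackCongr (show w ≫ v = w ≫ v' by rw [hv])).hom.app N).app U
        (((Scheme.Modules.pullbackComp w v).hom.app N).app U x) := by
  have h := congrArg (fun φ => Scheme.Modules.Hom.app φ U x) (pullback_map_pullbackCongr_comp_pullbackComp w hv N)
  simp only [Scheme.Modules.Hom.comp_app, CategoryTheory.comp_apply] at h
  exact h

/-- Components of a natural isomorphism of module-valued functors: `α⁻¹_N(α_N(x)) = x` on sections.
[cite: Hartshorne1977, II §5 (p. 109)] -/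
theorem natIso_inv_app_app_hom_app_app {C : Type*} [Category C] {F G : C ⥤ Y.Modules} (α : F ≅ G) (N : C)
    (U : Y.Opens) (x : Γ(F.obj N, U)) : (α.inv.app N).app U ((α.hom.app N).app U x) = x :=
  inv_app_hom_app (α.app N) U x

/-- Components of a natural isomorphism of module-valued functors: `α_N(α⁻¹_N(y)) = y` on sections.
[cite: Hartshorne1977, II §5 (p. 109)] -/
theorem natIso_hom_app_app_inv_app_app {C : Type*} [Category C] {F G : C ⥤ Y.Modules} (α : F ≅ G) (N : C)
    (U : Y.Opens) (y : Γ(G.obj N, U)) : (α.hom.app N).app U ((α.inv.app N).app U y) = y :=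
  hom_app_inv_app (α.app N) U y


end Transport

end Literature.AlgebraicGeometry.Modules

namespace Literature.AlgebraicGeometry.Morphisms

open Literature.AlgebraicGeometry.Modules

/-! ## §0 The comparison `u_v : v^*𝒪 ⟶ 𝒪` on the unit section -/

section UnitComparison

variable {X' Y' : Scheme.{u}} (v : X' ⟶ Y')

/-- `η_v(y) = v♯(y) · η_v(1)` for a GLOBAL function `y` (★ `RelativeSpec.ActionOver.unitSection_unit_eq` at `V = ⊤`, the
restriction `v⁻¹⊤ ≤ v⁻¹⊤` being the identity). [cite: Hartshorne1977, II §5 (p. 110)] -/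
theorem unitSection_unit_top_eq (y : Γ(Y', ⊤)) :
    unitSection v (SheafOfModules.unit Y'.ringCatSheaf) ⊤ y =
      v.app ⊤ y • unitSection v (SheafOfModules.unit Y'.ringCatSheaf) ⊤ (1 : Γ(Y', ⊤)) := by
  rw [← unitSection_smul, smul_unit_eq_mul]
  congr 1
  exact (mul_one y).symm

/-- `u_v⁻¹(1) = η_v(1)`: the inverse of the (iso)morphism `u_v : v^*𝒪 ⟶ 𝒪` (★ `pullbackUnitComparison`) sends `1` to the
pulled-back unit. [cite: StacksProject, Tag 0095] -/
theorem inv_pullbackUnitComparison_app_top_one :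
    (inv (pullbackUnitComparison v) (I := isIso_pullbackUnitComparison v)).app ⊤ (1 : Γ(X', ⊤)) =
      unitSection v (SheafOfModules.unit Y'.ringCatSheaf) ⊤ (1 : Γ(Y', ⊤)) := by
  haveI := isIso_pullbackUnitComparison v
  apply app_injective_of_iso (asIso (pullbackUnitComparison v)) ⊤
  change (pullbackUnitComparison v).app ⊤ ((inv (pullbackUnitComparison v)).app ⊤ (1 : Γ(X', ⊤))) =
    (pullbackUnitComparison v).app (v ⁻¹ᵁ ⊤) (unitSection v (unitModule Y') ⊤ (1 : Γ(Y', ⊤)))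
  rw [app_pullbackUnitComparison_unitSection, ← CategoryTheory.comp_apply, ← Scheme.Modules.Hom.comp_app,
    IsIso.inv_hom_id, Scheme.Modules.Hom.id_app]
  exact (map_one (v.app ⊤).hom).symm

end UnitComparison

/-! ## §1 The rigidification-normalised generator -/

section Normalised

variable {X T Z T₁ : Scheme.{u}} (e : T ⟶ X) (g : Z ⟶ X) (e₁ : T₁ ⟶ Z) (π₁ : Z ⟶ T₁) (c : T₁ ⟶ T)
  (h₁ : e₁ ≫ g = c ≫ e) (L : X.Modules)
  (ρ : (Scheme.Modules.pullback e).obj L ≅ SheafOfModules.unit T.ringCatSheaf)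
  (φ₀ : (Scheme.Modules.pullback g).obj L ≅ SheafOfModules.unit Z.ringCatSheaf)

/-- **The rigidification-normalised generator.**  Setting: `e : T → X` (a section of some `X → T`), `g : Z → X`,
`e₁ : T₁ → Z` a section of `π₁ : Z → T₁`, `c : T₁ → T` with `e₁ ≫ g = c ≫ e`; a module `L` on `X` RIGIDIFIED along `e`
(`ρ : e^*L ≅ 𝒪_T`) whose pull-back `g^*L` is TRIVIAL (`φ₀ : g^*L ≅ 𝒪_Z`).  Then there is a unit `a ∈ Γ(T₁, 𝒪)^×` such that
the generator `s₁ := φ₀⁻¹(π₁♯ a)` of `g^*L` is NORMALISED: its pull-back along `e₁`, read in `(c ≫ e)^*L`, is the pull-back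
along `c` of the rigidification generator `ρ⁻¹(1)`.  (The two trivialisations `κ` (from `ρ`) and `Θ` (from `φ₀`) of
`(c ≫ e)^*L` differ by the unit `a := Θ(κ⁻¹ 1)`, ★ `Modules.hom_app_inv_app_one_mul`.)
[cite: MumfordFogartyKirwan1994, Ch. 6 §2 (p. 121)] [cite: StacksProject, Tag 023M] -/
theorem exists_isUnit_normalised (he₁ : e₁ ≫ π₁ = 𝟙 T₁) :
    ∃ a : Γ(T₁, ⊤), IsUnit a ∧
      ((Scheme.Modules.pullbackCongr h₁).hom.app L).app ⊤
        (((Scheme.Modules.pullbackComp e₁ g).hom.app L).app ⊤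
          (unitSection e₁ ((Scheme.Modules.pullback g).obj L) ⊤ (φ₀.inv.app ⊤ (π₁.app ⊤ a)))) =
      ((Scheme.Modules.pullbackComp c e).hom.app L).app ⊤
        (unitSection c ((Scheme.Modules.pullback e).obj L) ⊤ (ρ.inv.app ⊤ (1 : Γ(T, ⊤)))) := by
  haveI := isIso_pullbackUnitComparison e₁
  haveI := isIso_pullbackUnitComparison c
  -- the two trivialisations of `(c ≫ e)^* L`: `κ` from the rigidification, `Θ` from `φ₀`
  let κ : (Scheme.Modules.pullback (c ≫ e)).obj L ≅ SheafOfModules.unit T₁.ringCatSheaf :=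
    ((Scheme.Modules.pullbackComp c e).app L).symm ≪≫ (Scheme.Modules.pullback c).mapIso ρ ≪≫
      asIso (pullbackUnitComparison c)
  let Θ : (Scheme.Modules.pullback (c ≫ e)).obj L ≅ SheafOfModules.unit T₁.ringCatSheaf :=
    ((Scheme.Modules.pullbackCongr h₁).app L).symm ≪≫ ((Scheme.Modules.pullbackComp e₁ g).app L).symm ≪≫
      (Scheme.Modules.pullback e₁).mapIso φ₀ ≪≫ asIso (pullbackUnitComparison e₁)
  refine ⟨Θ.hom.app ⊤ (κ.inv.app ⊤ (1 : Γ(T₁, ⊤))), isUnit_hom_app_inv_app_one ⊤ Θ κ, ?_⟩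
  set a : Γ(T₁, ⊤) := Θ.hom.app ⊤ (κ.inv.app ⊤ (1 : Γ(T₁, ⊤))) with ha
  -- `η_{e₁}(φ₀⁻¹(π₁♯ a)) = e₁^*φ₀⁻¹ (η_{e₁}(π₁♯ a)) = e₁^*φ₀⁻¹ (a • η_{e₁} 1)`
  have step1 : unitSection e₁ ((Scheme.Modules.pullback g).obj L) ⊤ (φ₀.inv.app ⊤ (π₁.app ⊤ a)) =
      ((Scheme.Modules.pullback e₁).map φ₀.inv).app ⊤
        (unitSection e₁ (SheafOfModules.unit Z.ringCatSheaf) ⊤ (π₁.app ⊤ a)) :=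
    (pullback_map_app_unitSection e₁ φ₀.inv ⊤ (π₁.app ⊤ a)).symm
  have step2 : unitSection e₁ (SheafOfModules.unit Z.ringCatSheaf) ⊤ (π₁.app ⊤ a) =
      a • (show Γ((Scheme.Modules.pullback e₁).obj (SheafOfModules.unit Z.ringCatSheaf), ⊤) from
        unitSection e₁ (SheafOfModules.unit Z.ringCatSheaf) ⊤ (1 : Γ(Z, ⊤))) := by
    have h := unitSection_unit_top_eq e₁ (π₁.app ⊤ a)
    have h' : e₁.app (π₁ ⁻¹ᵁ ⊤) (π₁.app ⊤ a) = a := app_app_top_of_comp_eq_id e₁ π₁ he₁ a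
    rw [h]
    exact congrArg (fun r : Γ(T₁, ⊤) => r • (show Γ((Scheme.Modules.pullback e₁).obj
      (SheafOfModules.unit Z.ringCatSheaf), ⊤) from unitSection e₁ (SheafOfModules.unit Z.ringCatSheaf) ⊤ (1 : Γ(Z, ⊤))))
      h'
  -- `e₁^*φ₀⁻¹ (η_{e₁} 1)`, read through the two canonical maps, is `Θ⁻¹(1)`
  have step3 : ((Scheme.Modules.pullbackCongr h₁).hom.app L).app ⊤
      (((Scheme.Modules.pullbackComp e₁ g).hom.app L).app ⊤
        (((Scheme.Modules.pullback e₁).map φ₀.inv).app ⊤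
          (unitSection e₁ (SheafOfModules.unit Z.ringCatSheaf) ⊤ (1 : Γ(Z, ⊤))))) =
      Θ.inv.app ⊤ (1 : Γ(T₁, ⊤)) := by
    rw [← inv_pullbackUnitComparison_app_top_one e₁]
    rfl
  -- `κ⁻¹(1)` is the right-hand side
  have step4 : κ.inv.app ⊤ (1 : Γ(T₁, ⊤)) =
      ((Scheme.Modules.pullbackComp c e).hom.app L).app ⊤
        (unitSection c ((Scheme.Modules.pullback e).obj L) ⊤ (ρ.inv.app ⊤ (1 : Γ(T, ⊤)))) := by
    rw [← pullback_map_app_unitSection c ρ.inv ⊤, ← inv_pullbackUnitComparison_app_top_one c]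
    rfl
  rw [step1, step2, Scheme.Modules.Hom.app_smul, Scheme.Modules.Hom.app_smul, Scheme.Modules.Hom.app_smul, step3,
    ← step4, eq_smul_inv_app_one κ ⊤ (Θ.inv.app ⊤ (1 : Γ(T₁, ⊤))), ← mul_smul]
  have hunit : @HMul.hMul Γ(T₁, ⊤) Γ(T₁, ⊤) Γ(T₁, ⊤) instHMul a
      (show Γ(T₁, ⊤) from κ.hom.app ⊤ (Θ.inv.app ⊤ (1 : Γ(T₁, ⊤)))) = 1 :=
    hom_app_inv_app_one_mul ⊤ Θ κ
  rw [hunit, one_smul]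

end Normalised

/-! ## §2 The coface of the normalised generator read along a section (LEMMA Y) -/

section Coface

variable {X T Z T₁ : Scheme.{u}} (e : T ⟶ X) (g : Z ⟶ X) (e₁ : T₁ ⟶ Z) (c : T₁ ⟶ T)
  (L : X.Modules) (ρ : (Scheme.Modules.pullback e).obj L ≅ SheafOfModules.unit T.ringCatSheaf)
  {Z' T' : Scheme.{u}} (e' : T' ⟶ Z') (p : Z' ⟶ Z) (w : T' ⟶ T₁)
  (s₁ : Γ((Scheme.Modules.pullback g).obj L, ⊤))

/-- The base equation of LEMMA Y: `(w ≫ c) ≫ e = e′ ≫ p ≫ g`. [cite: StacksProject, Tag 023M] -/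
theorem comp_comp_eq_of_sections (h₁ : e₁ ≫ g = c ≫ e) (hp : e' ≫ p = w ≫ e₁) : (w ≫ c) ≫ e = e' ≫ p ≫ g := by
  rw [Category.assoc, ← h₁, ← Category.assoc, ← hp, Category.assoc]

/-- **LEMMA Y — the `w`-coface of a normalised generator, read along the section `e′`, is the rigidification
generator pulled back along `w ≫ c`** (global sections, every component read at `⊤`).  Setting of
`exists_isUnit_normalised` plus a second level `e′ : T′ → Z′`, `p : Z′ → Z`, `w : T′ → T₁` with `e′ ≫ p = w ≫ e₁`; `s₁` a
global section of `g^*L` NORMALISED along `e₁` (hypothesis `hs₁`).  Then `η_{e′}` of the coface (`(p ≫ g)^*`-reading of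
`η_p(s₁)`), read in `(e′ ≫ p ≫ g)^*L`, is the transport of the `((w ≫ c) ≫ e)^*`-reading of `η_{w ≫ c}(ρ⁻¹ 1)`.  Pure
pseudofunctor bookkeeping: associativity of `pullbackComp` (★ `Modules.pullbackComp_assoc_hom_app_apply`, from Mathlib
`SheafOfModules.pullback_assoc`) three times, naturality of the unit (★ `pullback_map_app_unitSection`), ★
`pullbackComp_hom_app_unitSection`, and transport along `e′ ≫ p = w ≫ e₁`, `e₁ ≫ g = c ≫ e`.
[cite: StacksProject, Tag 023M] [cite: GortzWedhorn2020, Prop. 14.66] -/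
theorem unitSection_coface_eq_transport (h₁ : e₁ ≫ g = c ≫ e) (hp : e' ≫ p = w ≫ e₁)
    (hs₁ : ((Scheme.Modules.pullbackCongr h₁).hom.app L).app ⊤
        (((Scheme.Modules.pullbackComp e₁ g).hom.app L).app ⊤
          (unitSection e₁ ((Scheme.Modules.pullback g).obj L) ⊤ s₁)) =
      ((Scheme.Modules.pullbackComp c e).hom.app L).app ⊤
        (unitSection c ((Scheme.Modules.pullback e).obj L) ⊤ (ρ.inv.app ⊤ (1 : Γ(T, ⊤))))) :
    ((Scheme.Modules.pullbackComp e' (p ≫ g)).hom.app L).app ⊤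
        (unitSection e' ((Scheme.Modules.pullback (p ≫ g)).obj L) ⊤
          (((Scheme.Modules.pullbackComp p g).hom.app L).app ⊤
            (unitSection p ((Scheme.Modules.pullback g).obj L) ⊤ s₁))) =
      ((Scheme.Modules.pullbackCongr (comp_comp_eq_of_sections e g e₁ c e' p w h₁ hp)).hom.app L).app ⊤
        (((Scheme.Modules.pullbackComp (w ≫ c) e).hom.app L).app ⊤
          (unitSection (w ≫ c) ((Scheme.Modules.pullback e).obj L) ⊤ (ρ.inv.app ⊤ (1 : Γ(T, ⊤))))) := by
  -- notation in the comments: `r := ρ⁻¹(1)`, `x₁ := C_{e₁,g}(η_{e₁}(s₁))`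
  -- (1) `η_{e′}` past the coface map, then associativity: `Y = C_{e′ ≫ p, g}(η_{e′ ≫ p}(s₁))`
  have n1 : unitSection e' ((Scheme.Modules.pullback (p ≫ g)).obj L) ⊤
        (((Scheme.Modules.pullbackComp p g).hom.app L).app ⊤ (unitSection p ((Scheme.Modules.pullback g).obj L) ⊤ s₁)) =
      ((Scheme.Modules.pullback e').map ((Scheme.Modules.pullbackComp p g).hom.app L)).app ⊤
        (unitSection e' ((Scheme.Modules.pullback p).obj ((Scheme.Modules.pullback g).obj L)) ⊤ (unitSection p
            ((Scheme.Modules.pullback g).obj L) ⊤ s₁)) :=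
    (pullback_map_app_top_unitSection_top e' ((Scheme.Modules.pullbackComp p g).hom.app L) _).symm
  have a1 : ((Scheme.Modules.pullbackComp (e' ≫ p) g).hom.app L).app ⊤
        (((Scheme.Modules.pullbackComp e' p).hom.app ((Scheme.Modules.pullback g).obj L)).app ⊤
          (unitSection e' ((Scheme.Modules.pullback p).obj ((Scheme.Modules.pullback g).obj L)) ⊤ (unitSection p
              ((Scheme.Modules.pullback g).obj L) ⊤ s₁))) =
      ((Scheme.Modules.pullbackComp e' (p ≫ g)).hom.app L).app ⊤
        (((Scheme.Modules.pullback e').map ((Scheme.Modules.pullbackComp p g).hom.app L)).app ⊤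
          (unitSection e' ((Scheme.Modules.pullback p).obj ((Scheme.Modules.pullback g).obj L)) ⊤ (unitSection p
              ((Scheme.Modules.pullback g).obj L) ⊤ s₁))) :=
    pullbackComp_assoc_hom_app_apply e' p g L ⊤ _
  have u1 : ((Scheme.Modules.pullbackComp e' p).hom.app ((Scheme.Modules.pullback g).obj L)).app ⊤
        (unitSection e' ((Scheme.Modules.pullback p).obj ((Scheme.Modules.pullback g).obj L)) ⊤ (unitSection p
            ((Scheme.Modules.pullback g).obj L) ⊤ s₁)) =
      unitSection (e' ≫ p) ((Scheme.Modules.pullback g).obj L) ⊤ s₁ :=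
    pullbackComp_hom_app_top_unitSection_top e' p ((Scheme.Modules.pullback g).obj L) s₁
  have y1 : ((Scheme.Modules.pullbackComp e' (p ≫ g)).hom.app L).app ⊤
        (unitSection e' ((Scheme.Modules.pullback (p ≫ g)).obj L) ⊤
          (((Scheme.Modules.pullbackComp p g).hom.app L).app ⊤ (unitSection p ((Scheme.Modules.pullback g).obj L) ⊤ s₁))) =
      ((Scheme.Modules.pullbackComp (e' ≫ p) g).hom.app L).app ⊤ (unitSection (e' ≫ p) ((Scheme.Modules.pullback
          g).obj L) ⊤ s₁) := by
    rw [n1, ← a1, u1]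
  -- (2) transport along `e′ ≫ p = w ≫ e₁`
  have ha : (e' ≫ p) ≫ g = w ≫ e₁ ≫ g := by rw [hp, Category.assoc]
  have y2 : ((Scheme.Modules.pullbackCongr ha).hom.app L).app ⊤
        (((Scheme.Modules.pullbackComp (e' ≫ p) g).hom.app L).app ⊤ (unitSection (e' ≫ p) ((Scheme.Modules.pullback
            g).obj L) ⊤ s₁)) =
      ((Scheme.Modules.pullbackComp (w ≫ e₁) g).hom.app L).app ⊤ (unitSection (w ≫ e₁) ((Scheme.Modules.pullback
          g).obj L) ⊤ s₁) :=
    pullbackComp_hom_app_unitSection_congr_left hp g L s₁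
  -- (3) associativity at `w, e₁, g` and naturality: `C_{w ≫ e₁, g}(η_{w ≫ e₁}(s₁)) = C_{w, e₁ ≫ g}(η_w(x₁))`
  have u3 : ((Scheme.Modules.pullbackComp w e₁).hom.app ((Scheme.Modules.pullback g).obj L)).app ⊤
        (unitSection w ((Scheme.Modules.pullback e₁).obj ((Scheme.Modules.pullback g).obj L)) ⊤ (unitSection e₁
            ((Scheme.Modules.pullback g).obj L) ⊤ s₁)) =
      unitSection (w ≫ e₁) ((Scheme.Modules.pullback g).obj L) ⊤ s₁ :=
    pullbackComp_hom_app_top_unitSection_top w e₁ ((Scheme.Modules.pullback g).obj L) s₁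
  have a3 : ((Scheme.Modules.pullbackComp (w ≫ e₁) g).hom.app L).app ⊤
        (((Scheme.Modules.pullbackComp w e₁).hom.app ((Scheme.Modules.pullback g).obj L)).app ⊤
          (unitSection w ((Scheme.Modules.pullback e₁).obj ((Scheme.Modules.pullback g).obj L)) ⊤ (unitSection e₁
              ((Scheme.Modules.pullback g).obj L) ⊤ s₁))) =
      ((Scheme.Modules.pullbackComp w (e₁ ≫ g)).hom.app L).app ⊤
        (((Scheme.Modules.pullback w).map ((Scheme.Modules.pullbackComp e₁ g).hom.app L)).app ⊤
          (unitSection w ((Scheme.Modules.pullback e₁).obj ((Scheme.Modules.pullback g).obj L)) ⊤ (unitSection e₁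
              ((Scheme.Modules.pullback g).obj L) ⊤ s₁))) :=
    pullbackComp_assoc_hom_app_apply w e₁ g L ⊤ _
  have n3 : ((Scheme.Modules.pullback w).map ((Scheme.Modules.pullbackComp e₁ g).hom.app L)).app ⊤
        (unitSection w ((Scheme.Modules.pullback e₁).obj ((Scheme.Modules.pullback g).obj L)) ⊤ (unitSection e₁
            ((Scheme.Modules.pullback g).obj L) ⊤ s₁)) =
      unitSection w ((Scheme.Modules.pullback (e₁ ≫ g)).obj L) ⊤ (((Scheme.Modules.pullbackComp e₁ g).hom.app L).app
          ⊤ (unitSection e₁ ((Scheme.Modules.pullback g).obj L) ⊤ s₁)) :=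
    pullback_map_app_top_unitSection_top w ((Scheme.Modules.pullbackComp e₁ g).hom.app L) _
  have y3 : ((Scheme.Modules.pullbackComp (w ≫ e₁) g).hom.app L).app ⊤ (unitSection (w ≫ e₁)
      ((Scheme.Modules.pullback g).obj L) ⊤ s₁) =
      ((Scheme.Modules.pullbackComp w (e₁ ≫ g)).hom.app L).app ⊤
        (unitSection w ((Scheme.Modules.pullback (e₁ ≫ g)).obj L) ⊤ (((Scheme.Modules.pullbackComp e₁ g).hom.app
            L).app ⊤ (unitSection e₁ ((Scheme.Modules.pullback g).obj L) ⊤ s₁))) := by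
    rw [← u3, a3, n3]
  -- (4) transport along `e₁ ≫ g = c ≫ e` and the normalisation `hs₁`
  have hb : w ≫ e₁ ≫ g = w ≫ c ≫ e := by rw [h₁]
  have y4 : ((Scheme.Modules.pullbackCongr hb).hom.app L).app ⊤
        (((Scheme.Modules.pullbackComp w (e₁ ≫ g)).hom.app L).app ⊤
          (unitSection w ((Scheme.Modules.pullback (e₁ ≫ g)).obj L) ⊤ (((Scheme.Modules.pullbackComp e₁ g).hom.app
              L).app ⊤ (unitSection e₁ ((Scheme.Modules.pullback g).obj L) ⊤ s₁)))) =
      ((Scheme.Modules.pullbackComp w (c ≫ e)).hom.app L).app ⊤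
        (unitSection w ((Scheme.Modules.pullback (c ≫ e)).obj L) ⊤
          (((Scheme.Modules.pullbackComp c e).hom.app L).app ⊤ (unitSection c ((Scheme.Modules.pullback e).obj L) ⊤
              (ρ.inv.app ⊤ (1 : Γ(T, ⊤)))))) := by
    rw [← hs₁]
    exact pullbackComp_hom_app_unitSection_congr_right w h₁ L (((Scheme.Modules.pullbackComp e₁ g).hom.app L).app ⊤
        (unitSection e₁ ((Scheme.Modules.pullback g).obj L) ⊤ s₁))
  -- (5) naturality and associativity at `w, c, e`: `C_{w, c ≫ e}(η_w(C_{c,e}(η_c r))) = C_{w ≫ c, e}(η_{w ≫ c} r)`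
  have u5 : ((Scheme.Modules.pullbackComp w c).hom.app ((Scheme.Modules.pullback e).obj L)).app ⊤
        (unitSection w ((Scheme.Modules.pullback c).obj ((Scheme.Modules.pullback e).obj L)) ⊤ (unitSection c
            ((Scheme.Modules.pullback e).obj L) ⊤ (ρ.inv.app ⊤ (1 : Γ(T, ⊤))))) =
      unitSection (w ≫ c) ((Scheme.Modules.pullback e).obj L) ⊤ (ρ.inv.app ⊤ (1 : Γ(T, ⊤))) :=
    pullbackComp_hom_app_top_unitSection_top w c ((Scheme.Modules.pullback e).obj L) (ρ.inv.app ⊤ (1 : Γ(T, ⊤)))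
  have a5 : ((Scheme.Modules.pullbackComp (w ≫ c) e).hom.app L).app ⊤
        (((Scheme.Modules.pullbackComp w c).hom.app ((Scheme.Modules.pullback e).obj L)).app ⊤
          (unitSection w ((Scheme.Modules.pullback c).obj ((Scheme.Modules.pullback e).obj L)) ⊤ (unitSection c
              ((Scheme.Modules.pullback e).obj L) ⊤ (ρ.inv.app ⊤ (1 : Γ(T, ⊤)))))) =
      ((Scheme.Modules.pullbackComp w (c ≫ e)).hom.app L).app ⊤
        (((Scheme.Modules.pullback w).map ((Scheme.Modules.pullbackComp c e).hom.app L)).app ⊤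
          (unitSection w ((Scheme.Modules.pullback c).obj ((Scheme.Modules.pullback e).obj L)) ⊤ (unitSection c
              ((Scheme.Modules.pullback e).obj L) ⊤ (ρ.inv.app ⊤ (1 : Γ(T, ⊤)))))) :=
    pullbackComp_assoc_hom_app_apply w c e L ⊤ _
  have n5 : ((Scheme.Modules.pullback w).map ((Scheme.Modules.pullbackComp c e).hom.app L)).app ⊤
        (unitSection w ((Scheme.Modules.pullback c).obj ((Scheme.Modules.pullback e).obj L)) ⊤ (unitSection c
            ((Scheme.Modules.pullback e).obj L) ⊤ (ρ.inv.app ⊤ (1 : Γ(T, ⊤))))) =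
      unitSection w ((Scheme.Modules.pullback (c ≫ e)).obj L) ⊤
        (((Scheme.Modules.pullbackComp c e).hom.app L).app ⊤ (unitSection c ((Scheme.Modules.pullback e).obj L) ⊤
            (ρ.inv.app ⊤ (1 : Γ(T, ⊤))))) :=
    pullback_map_app_top_unitSection_top w ((Scheme.Modules.pullbackComp c e).hom.app L) _
  have y5 : ((Scheme.Modules.pullbackComp w (c ≫ e)).hom.app L).app ⊤
        (unitSection w ((Scheme.Modules.pullback (c ≫ e)).obj L) ⊤
          (((Scheme.Modules.pullbackComp c e).hom.app L).app ⊤ (unitSection c ((Scheme.Modules.pullback e).obj L) ⊤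
              (ρ.inv.app ⊤ (1 : Γ(T, ⊤)))))) =
      ((Scheme.Modules.pullbackComp (w ≫ c) e).hom.app L).app ⊤ (unitSection (w ≫ c) ((Scheme.Modules.pullback e).obj
          L) ⊤ (ρ.inv.app ⊤ (1 : Γ(T, ⊤)))) := by
    rw [← n5, ← a5, u5]
  -- (6) assemble: `T_b (T_a Y) = Rho`
  have key : ((Scheme.Modules.pullbackCongr (ha.trans hb)).hom.app L).app ⊤
      (((Scheme.Modules.pullbackComp e' (p ≫ g)).hom.app L).app ⊤
        (unitSection e' ((Scheme.Modules.pullback (p ≫ g)).obj L) ⊤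
          (((Scheme.Modules.pullbackComp p g).hom.app L).app ⊤ (unitSection p ((Scheme.Modules.pullback g).obj L) ⊤ s₁)))) =
      ((Scheme.Modules.pullbackComp (w ≫ c) e).hom.app L).app ⊤ (unitSection (w ≫ c) ((Scheme.Modules.pullback e).obj
          L) ⊤ (ρ.inv.app ⊤ (1 : Γ(T, ⊤)))) := by
    rw [← pullbackCongr_hom_app_app_trans ha hb, y1, y2, y3, y4, y5]
  have key' := congrArg (((Scheme.Modules.pullbackCongr (ha.trans hb).symm).hom.app L).app ⊤) key
  rw [pullbackCongr_hom_app_app_trans, pullbackCongr_hom_app_app_self] at key'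
  exact key'

end Coface

end Literature.AlgebraicGeometry.Morphisms

end
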